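import Mathlib
import Summits.AnomalousDissipation.AnomalousDissipation.Theses.LimitingAbsorption
import Literature.Analysis.FluidPDE.SeisDissipationRateBound

/-!
# Sketch (ideator 1, round 1) — crux `LimitingAbsorption.UniformRelaxationWitness`
# (stmt-AnomalousDissipation-2937)

First lemmas of the idea card `upo-floquet-witness` and the statements behind the negative notes
N1 (coherent-vorticity-memory gate). Statements only (`def … : Prop`) plus one proved bookkeeping
lemma; nothing here is a route item.
-/

noncomputable section

-- D-0017: single-conjunct summit ⇒ `Summit.AnomalousDissipation.AnomalousDissipation.…`.
set_option linter.dupNamespace false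

namespace Summit.AnomalousDissipation.AnomalousDissipation.Cruxes.UniformRelaxationWitness.SketchIdeator1

open MeasureTheory Set Filter
open scoped ENNReal NNReal

open Literature.Analysis.FunctionSpaces Literature.Analysis.FluidPDE

/-- The flat unit torus `T²` (local notation). -/
local notation "𝕋²" => UnitAddTorus (Fin 2)
/-- Planar vectors (local notation). -/
local notation "E²" => EuclideanSpace ℝ (Fin 2)

/-! ## The two scalar clauses of the crux, for ONE velocity field -/

/-- `(U_h)` for one field: every weak solution of `∂ₜθ + u(s+·)·∇θ = κΔθ`, `θ(0) = h`, from every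
phase `s ≥ 0`, decays like `C e^{-γ t}` in `L²` (the crux's relaxation clause with `u = v j`,
`κ = ν j`). -/
def PhaseUniformRelaxation (κ : ℝ) (u : ℝ → 𝕋² → E²) (h : 𝕋² → ℝ) (C γ : ℝ) : Prop :=
  ∀ s : ℝ, 0 ≤ s → ∀ (T : ℝ) (θ : ℝ → 𝕋² → ℝ),
    Torus.IsWeakScalarTransportOn T κ (fun t => u (s + t)) h θ →
      ∀ᵐ t ∂(volume.restrict (Ioo (0 : ℝ) T)),
        Torus.scalarL2Sq (θ t) ≤ C * Real.exp (-(γ * t)) * Torus.scalarL2Sq h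

/-- `(U_h)` with the phases restricted to a window `[0, τ]` (what a `τ`-periodic field needs). -/
def WindowRelaxation (κ : ℝ) (u : ℝ → 𝕋² → E²) (h : 𝕋² → ℝ) (C γ τ : ℝ) : Prop :=
  ∀ s : ℝ, 0 ≤ s → s ≤ τ → ∀ (T : ℝ) (θ : ℝ → 𝕋² → ℝ),
    Torus.IsWeakScalarTransportOn T κ (fun t => u (s + t)) h θ →
      ∀ᵐ t ∂(volume.restrict (Ioo (0 : ℝ) T)),
        Torus.scalarL2Sq (θ t) ≤ C * Real.exp (-(γ * t)) * Torus.scalarL2Sq h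

/-- `(ABS)` for one field: some weak solution of the `h`-sourced problem from zero datum has
`limsup`-mean dissipation `≥ ε`. -/
def DissipationFloor (κ : ℝ) (u : ℝ → 𝕋² → E²) (h : 𝕋² → ℝ) (ε : ℝ) : Prop :=
  ∃ θ : ℝ → 𝕋² → ℝ, Torus.IsWeakScalarTransportForced κ u (fun _ => h) 0 θ ∧
    ε ≤ longTimeAvgSup (fun t => κ * (Torus.eScalarGradNormSq (θ t)).toReal)

/-! ## First lemma of `upo-floquet-witness`: periodicity compactifies the phases -/

/-- **Velocity locality in time** (support stub, routine): the weak-solution predicate on `[0,T)`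
sees the velocity only at times in `(0,T)` (every field of `Torus.IsWeakScalarTransportOn`
integrates over `Ioo 0 T` or restricts to `Ioo 0 T ×ˢ univ`). Proved. -/
theorem isWeakScalarTransportOn_congr_velocity {T κ : ℝ} {u₁ u₂ : ℝ → 𝕋² → E²}
    {θ₀ : 𝕋² → ℝ} {θ : ℝ → 𝕋² → ℝ} (h₁ : Torus.IsWeakScalarTransportOn T κ u₁ θ₀ θ)
    (hu : ∀ t ∈ Ioo (0 : ℝ) T, u₁ t = u₂ t) : Torus.IsWeakScalarTransportOn T κ u₂ θ₀ θ := by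
  have hS : MeasurableSet (Ioo (0 : ℝ) T ×ˢ (univ : Set E²)) := measurableSet_Ioo.prod .univ
  refine ⟨h₁.aestronglyMeasurable, ?_, h₁.ae_lintegral_sq_le, ?_, ?_, ?_, ?_⟩
  · -- velocity measurability: the lifts agree on the restricted set
    refine h₁.aestronglyMeasurable_velocity.congr ?_
    filter_upwards [ae_restrict_mem hS] with p hp
    rcases p with ⟨t, y⟩
    simp only [Torus.stLift_apply]
    rw [hu t (mem_prod.mp hp).1]
  · have e : ∫⁻ t in Ioo (0 : ℝ) T, (∫⁻ x, ‖u₂ t x‖ₑ ^ 2) ^ (1 / 2 : ℝ) =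
        ∫⁻ t in Ioo (0 : ℝ) T, (∫⁻ x, ‖u₁ t x‖ₑ ^ 2) ^ (1 / 2 : ℝ) :=
      setLIntegral_congr_fun measurableSet_Ioo (fun t ht => by rw [hu t ht])
    rw [e]
    exact h₁.lintegral_velocity_lt_top
  · have e : ∫⁻ t in Ioo (0 : ℝ) T, ∫⁻ x, ‖u₂ t x‖ₑ * ‖θ t x‖ₑ =
        ∫⁻ t in Ioo (0 : ℝ) T, ∫⁻ x, ‖u₁ t x‖ₑ * ‖θ t x‖ₑ :=
      setLIntegral_congr_fun measurableSet_Ioo (fun t ht => by rw [hu t ht])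
    rw [e]
    exact h₁.lintegral_mul_lt_top
  · filter_upwards [h₁.ae_isWeaklyDivFree, ae_restrict_mem measurableSet_Ioo] with t ht ht'
    rw [← hu t ht']
    exact ht
  · intro ψ hψ
    rw [← setIntegral_congr_fun measurableSet_Ioo
      (fun t ht => by simp only [hu t ht] : EqOn (fun t => ∫ x, θ t x *
        (Torus.timeDeriv ψ t x + inner ℝ (u₁ t x) (Torus.gradient (ψ t) x) +
          κ * Torus.laplacian (ψ t) x)) _ (Ioo (0 : ℝ) T))]
    exact h₁.weak_eq ψ hψ

/-- **Floquet phase reduction** (proved from the locality stub): for a field that is `τ`-periodic on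
`t ≥ 0`, relaxation from the phases of ONE period is relaxation from every phase, with the same
constants — "phase-uniformity is free on a periodic orbit". -/
theorem phaseUniformRelaxation_of_periodic {κ : ℝ} {u : ℝ → 𝕋² → E²} {h : 𝕋² → ℝ}
    {C γ τ : ℝ} (hτ : 0 < τ) (hper : ∀ t : ℝ, 0 ≤ t → u (t + τ) = u t)
    (hwin : WindowRelaxation κ u h C γ τ) : PhaseUniformRelaxation κ u h C γ := by
  intro s hs T θ hθ
  -- iterate the period: u (x + m τ) = u x for x ≥ 0
  have key : ∀ (m : ℕ) (x : ℝ), 0 ≤ x → u (x + m * τ) = u x := by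
    intro m
    induction m with
    | zero => intro x _; simp
    | succ m ih =>
      intro x hx
      have h1 : x + ((m + 1 : ℕ) : ℝ) * τ = (x + m * τ) + τ := by push_cast; ring
      rw [h1, hper _ (by positivity), ih x hx]
  -- reduce the phase modulo the period: s = n τ + r with r ∈ [0, τ)
  set n : ℕ := ⌊s / τ⌋₊ with hn
  have hn1 : (n : ℝ) * τ ≤ s := by
    calc (n : ℝ) * τ ≤ (s / τ) * τ := by
          gcongr; exact Nat.floor_le (div_nonneg hs hτ.le)
      _ = s := div_mul_cancel₀ s hτ.ne'
  have hn2 : s < ((n : ℝ) + 1) * τ := by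
    calc s = (s / τ) * τ := (div_mul_cancel₀ s hτ.ne').symm
      _ < ((n : ℝ) + 1) * τ := by gcongr; exact Nat.lt_floor_add_one (s / τ)
  set r : ℝ := s - n * τ with hr
  have hr0 : 0 ≤ r := by rw [hr]; linarith
  have hrτ : r ≤ τ := by rw [hr]; nlinarith
  have hθ' : Torus.IsWeakScalarTransportOn T κ (fun t => u (r + t)) h θ := by
    refine isWeakScalarTransportOn_congr_velocity hθ ?_
    intro t ht
    have hrt : 0 ≤ r + t := by linarith [ht.1]
    have : s + t = (r + t) + n * τ := by rw [hr]; ring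
    simp only [this, key n (r + t) hrt]
  exact hwin r hr0 hrτ T θ hθ'

/-! ## The transfer `C⁺ ⇒ crux`: periodic (unstable) orbits as witnesses -/

/-- **C⁺ (periodic witness).** A steady smooth admissible `g`, a smooth mean-zero `h`, `ν_j → 0`,
and for each `j` a CLASSICAL solution `(v j, p j)` of planar NS with force `g` on all of `ℝ` that is
`τ j`-periodic in time (an exact, typically unstable, periodic orbit selected by its own datum),
with one-period energy bound `E`, window relaxation of `h` with uniform `(C, γ)` over the phases of
one period, and the dissipation floor `ε`. -/
def PeriodicWitness : Prop :=
  ∃ (g : 𝕋² → E²) (h : 𝕋² → ℝ), Torus.IsSmooth g ∧ Torus.IsDivFree g ∧ Torus.HasZeroMean g ∧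
    Torus.IsSmooth h ∧ Torus.HasZeroMean h ∧
    ∃ (ν τ : ℕ → ℝ) (v : ℕ → ℝ → 𝕋² → E²) (p : ℕ → ℝ → 𝕋² → ℝ),
      (∀ j, 0 < ν j) ∧ Tendsto ν atTop (nhds 0) ∧ (∀ j, 0 < τ j) ∧
      (∀ j, Torus.IsClassicalNSSolutionOn Set.univ (ν j) (fun _ => g) (v j) (p j)) ∧
      (∀ j (t : ℝ), v j (t + τ j) = v j t) ∧
      (∃ E : ℝ, ∀ j (t : ℝ), 0 ≤ t → t ≤ τ j → ∫ x, ‖v j t x‖ ^ 2 ≤ E) ∧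
      (∃ C γ : ℝ, 0 ≤ C ∧ 0 < γ ∧ ∀ j, WindowRelaxation (ν j) (v j) h C γ (τ j)) ∧
      ∃ ε : ℝ, 0 < ε ∧ ∀ j, DissipationFloor (ν j) (v j) h ε

/-- **Transfer stub** `C⁺ → crux` (plumbing: classical periodic ⇒ global Leray–Hopf from datum
`v j 0` (2-D twin of `Torus.isGlobalLerayHopf_of_isClassicalNSSolutionOn`), smooth ⇒ locally
bounded, pointwise one-period energy bound ⇒ `meanEnergy ≤ E`, `phaseUniformRelaxation_of_periodic`). -/
def PeriodicWitnessTransfer : Prop :=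
  PeriodicWitness →
    Summit.AnomalousDissipation.AnomalousDissipation.Theses.LimitingAbsorption.UniformRelaxationWitness

/-! ## Negative-side statements behind note N1 (coherent-vorticity-memory gate) -/

/-- Planar curl `∂₁g₂ − ∂₂g₁` of a planar field (the source of the vorticity equation). -/
def planarCurl (g : 𝕋² → E²) (x : 𝕋²) : ℝ :=
  Torus.partialDeriv 0 (fun y => g y 1) x - Torus.partialDeriv 1 (fun y => g y 0) x

/-- **Enstrophy cap from force-curl relaxation** (Duhamel at `Pr = 1`; provable from the route's
`RelaxationBoundsInventory` engine applied to the vorticity, plus 2-D Leray–Hopf regularity):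
if the family relaxes the profile `curl g` phase-uniformly with constants `(C', γ')`, then along
every member the planar enstrophy `‖∇v_j(t)‖₂² = ‖ω_j(t)‖₂²` is eventually bounded by
`(1 + 2 √C' ‖curl g‖₂ / γ')²`, uniformly in `j` (the initial vorticity is forgotten at rate
`4π²ν_j` by Poincaré, the injected vorticity is a superposition of relaxing copies of `curl g`). -/
def EnstrophyCapOfCurlRelaxation : Prop :=
  ∀ (g : 𝕋² → E²) (ν : ℝ) (v₀ : 𝕋² → E²) (v : ℝ → 𝕋² → E²) (C' γ' : ℝ),
    Torus.IsSmooth g → Torus.IsDivFree g → Torus.HasZeroMean g → 0 < ν → 0 ≤ C' → 0 < γ' →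
    MemLp v₀ 2 volume →
    Torus.IsGlobalLerayHopf ν (fun _ => g) v₀ v →
    (∀ T : ℝ, 0 < T → MemLp (Torus.stLift v) ⊤ (volume.restrict (Ioo (0 : ℝ) T ×ˢ univ))) →
    PhaseUniformRelaxation ν v (planarCurl g) C' γ' →
      ∃ t₀ : ℝ, ∀ᵐ t ∂(volume.restrict (Ioi t₀)),
        (Torus.eGradNormSq (v t)).toReal ≤
          (1 + 2 * Real.sqrt C' * Real.sqrt (Torus.scalarL2Sq (planarCurl g)) / γ') ^ 2

/-- **No universal relaxer** (note N1(b); refutable-now strengthening of the crux): a bounded-energy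
steadily forced planar Leray–Hopf family CANNOT relax both `h ≠ 0` and `curl g` phase-uniformly and
`ν`-uniformly. Inputs: `EnstrophyCapOfCurlRelaxation` (enstrophy eventually `≤ M²` uniformly in
`j`) and the vendored `Seis2022_thm2_L2` after the time rescaling `t ↦ t/M` (rate `γ/M ≤
K/log(M/ν_j) → 0`, contradiction). In particular NS-generated stirring at bounded energy is never
a `ν`-uniform relaxer of ALL smooth profiles, and every witness of the crux keeps the `L²` norm of
transported copies of `curl g` for `≳ log(1/ν_j)` time units (coherent vorticity memory). -/
def NoUniversalRelaxer : Prop :=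
  Seis2022_thm2_L2 →
  ∀ (g : 𝕋² → E²) (h : 𝕋² → ℝ), Torus.IsSmooth g → Torus.IsDivFree g → Torus.HasZeroMean g →
    Torus.IsSmooth h → Torus.HasZeroMean h → h ≠ 0 →
    ∀ (ν : ℕ → ℝ) (v₀ : ℕ → 𝕋² → E²) (v : ℕ → ℝ → 𝕋² → E²),
      (∀ j, 0 < ν j) → Tendsto ν atTop (nhds 0) →
      (∀ j, MemLp (v₀ j) 2 volume) →
      (∀ j, Torus.IsGlobalLerayHopf (ν j) (fun _ => g) (v₀ j) (v j)) →
      (∀ j (T : ℝ), 0 < T → MemLp (Torus.stLift (v j)) ⊤ (volume.restrict (Ioo (0 : ℝ) T ×ˢ univ))) →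
      (∃ C γ : ℝ, 0 ≤ C ∧ 0 < γ ∧ ∀ j, PhaseUniformRelaxation (ν j) (v j) h C γ) →
      (∃ C' γ' : ℝ, 0 ≤ C' ∧ 0 < γ' ∧ ∀ j, PhaseUniformRelaxation (ν j) (v j) (planarCurl g) C' γ') →
        False

/-! ## Floor from fast relaxation (support-level observation, see the card's `Leans on`) -/

/-- **Floor from fast relaxation**: with a pointwise energy bound `‖v(t)‖₂ ≤ U` and smooth `h`, the
Green–Kubo integrand `⟨h, P(t,τ)h⟩` stays `≥ ‖h‖²/2` for lags `≤ τ₀ := ‖h‖₂/(2(U‖∇h‖_∞ + κ‖Δh‖₂))`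
(test the weak formulation with `h`), while `(U_h)` bounds the tail by `(2√C/γ) e^{-γτ₀/2}‖h‖²`;
hence the sourced solution from zero datum has `limsup`-mean dissipation
`≥ ‖h‖² (τ₀/2 − (2√C/γ) e^{-γ τ₀/2})`, a floor whenever `γ τ₀ e^{γ τ₀ /2} > 4 √C`. Stated as the
implication it yields for one field. -/
def FloorFromFastRelaxation : Prop :=
  ∀ (κ U A : ℝ) (u : ℝ → 𝕋² → E²) (h : 𝕋² → ℝ) (C γ : ℝ), 0 < κ → 0 ≤ U → 0 ≤ A → 1 ≤ C → 0 < γ →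
    Torus.IsSmooth h → Torus.HasZeroMean h →
    (∀ x, ‖Torus.gradient h x‖ ≤ A) →
    (∀ t : ℝ, 0 ≤ t → ∫ x, ‖u t x‖ ^ 2 ≤ U ^ 2) →
    (∀ T : ℝ, 0 < T → MemLp (Torus.stLift u) ⊤ (volume.restrict (Ioo (0 : ℝ) T ×ˢ univ))) →
    (∀ᵐ t ∂(volume.restrict (Ioi (0 : ℝ))), Torus.IsWeaklyDivFree (u t)) →
    PhaseUniformRelaxation κ u h C γ →
    let τ₀ : ℝ := Real.sqrt (Torus.scalarL2Sq h) /
      (2 * (U * A + κ * Real.sqrt (∫ x, (Torus.laplacian h x) ^ 2)) + 1)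
    4 * Real.sqrt C < γ * τ₀ * Real.exp (γ * τ₀ / 2) →
      DissipationFloor κ u h
        (Torus.scalarL2Sq h * (τ₀ / 2 - 2 * Real.sqrt C / γ * Real.exp (-(γ * τ₀ / 2))))

/-! ## Card `odd-sector-universal-lap`: the half-shift sector and sector-universal stability -/

/-- The half-shift `S : (x₁, x₂) ↦ (x₁ + ½, x₂)` of `T²` (a measure-preserving translation of order 2). -/
def halfShift (x : 𝕋²) : 𝕋² := x + fun i => if i = 0 then ((1 / 2 : ℝ) : UnitAddCircle) else 0

/-- `S`-invariance of a (time-dependent) planar velocity field: `u t (S x) = u t x`. -/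
def IsHalfShiftInvariant (u : ℝ → 𝕋² → E²) : Prop := ∀ t x, u t (halfShift x) = u t x

/-- `S`-odd scalar profiles: `θ (S x) = - θ x` (only odd `k₁`-modes; in particular NO zonal component). -/
def IsHalfShiftOdd (θ : 𝕋² → ℝ) : Prop := ∀ x, θ (halfShift x) = -θ x

/-- **Sector invariance** (support, provable now: change of variables `x ↦ S x` in every conjunct of the
weak formulation, test functions `ψ ∘ S`; `S` is a measure-preserving homeomorphism commuting with
`∂ₜ, ∇, Δ`): for an `S`-invariant velocity, `θ` is a weak solution from `θ₀` iff `-(θ ∘ S)` is a weak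
solution from `-(θ₀ ∘ S)`; hence, whenever weak solutions are unique (bounded `u`, `κ > 0`), `S`-odd
data stay `S`-odd for a.e. time and are `L²`-orthogonal to every `S`-even field (ω, ψ, curl g, …). -/
def OddSectorInvariance : Prop :=
  ∀ (T κ : ℝ) (u : ℝ → 𝕋² → E²) (θ₀ : 𝕋² → ℝ) (θ : ℝ → 𝕋² → ℝ), IsHalfShiftInvariant u →
    Torus.IsWeakScalarTransportOn T κ u θ₀ θ →
      Torus.IsWeakScalarTransportOn T κ u (fun x => -θ₀ (halfShift x)) (fun t x => -θ t (halfShift x))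

/-- **Sector-universal uniform stability** (the core hypothesis of card `odd-sector-universal-lap`):
the scalar cocycle of `u` with diffusivity `κ` is exponentially stable on ALL `S`-odd `L²` data, from
every phase, with constants `(C, γ)` — a statement with no distinguished profile (Datko–Pazy form of a
limiting absorption principle on the odd subspace). -/
def OddSectorUniformStability (κ : ℝ) (u : ℝ → 𝕋² → E²) (C γ : ℝ) : Prop :=
  ∀ θ₀ : 𝕋² → ℝ, MemLp θ₀ 2 volume → IsHalfShiftOdd θ₀ → PhaseUniformRelaxation κ u θ₀ C γ

/-- The trivial direction used by the card: sector-universal stability gives `(U_h)` for every odd `L²`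
profile, in particular for the smooth odd `h` of the witness (proved: instantiate). -/
theorem phaseUniformRelaxation_of_oddSector {κ : ℝ} {u : ℝ → 𝕋² → E²} {C γ : ℝ}
    (hst : OddSectorUniformStability κ u C γ) {h : 𝕋² → ℝ} (hh : MemLp h 2 volume)
    (hodd : IsHalfShiftOdd h) : PhaseUniformRelaxation κ u h C γ :=
  hst h hh hodd

/-- **Necessary gradient growth under sector-universality** (un-mixing data; the `L^∞` companion of
Seis that the card must honour): if `OddSectorUniformStability (ν j) (v j) C γ` holds along a family
with `sup_t ‖∇v_j(t)‖_{L^∞} ≤ Λ j`, then `Λ j ≥ γ log(1/ν j) / (c₀ log (C + 1))` eventually, for an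
absolute `c₀` — stated here as the contrapositive-free inequality the line must budget for. -/
def OddUniversalityNeedsLipschitzGrowth : Prop :=
  ∃ c₀ : ℝ, 0 < c₀ ∧ ∀ (ν Λ : ℕ → ℝ) (v : ℕ → ℝ → 𝕋² → E²) (C γ : ℝ), 1 ≤ C → 0 < γ →
    (∀ j, 0 < ν j) → Tendsto ν atTop (nhds 0) →
    (∀ j, IsHalfShiftInvariant (v j)) →
    (∀ j (t : ℝ) (x y : 𝕋²), ‖v j t x - v j t y‖ ≤ Λ j * dist x y) →
    (∀ j, OddSectorUniformStability (ν j) (v j) C γ) →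
      ∀ᶠ j in atTop, γ * Real.log (ν j)⁻¹ / (c₀ * Real.log (C + 1)) ≤ Λ j

end Summit.AnomalousDissipation.AnomalousDissipation.Cruxes.UniformRelaxationWitness.SketchIdeator1

end
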